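import Summits.AtomisticToContinuum.BoseEinsteinCondensation.Theses.BECInsertionCorrector

/-!
# Route `BECInsertionCorrector`, support item `StaticResponseToHMinusOne`
# (stmt-AtomisticToContinuum-12060) — I: a measurable envelope for the pair interaction

The item quantifies over ARBITRARY pair profiles `v : ℝ → ℝ≥0∞` (no measurability), so the
interaction `W_v = ∑_{i<j} v^per(xᵢ - xⱼ)` entering `periodicEnergy` through the *lower* Lebesgue
integral need not be measurable, and `Ψ ↦ ∫⁻ W_v |Ψ|²` is a priori only super-additive. We repair
this once and for all: on a finite measure space every `f : α → ℝ≥0∞` has a measurable minorant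
`g ≤ f` that is an ESSENTIAL UPPER BOUND of all measurable minorants (`exists_measurable_envelope`),
whence `∫⁻ f·h = ∫⁻ g·h` for every finite-valued measurable `h` (`lintegral_mul_eq_of_envelope`).
Applied on the fundamental cell this yields a measurable weight `W ≤ W_v` with
`periodicEnergy v Ψ = ∫⁻_cell |∇Ψ|² + W|Ψ|²` for every periodic trial state `Ψ`
(`exists_measurable_weight`): all later files work with a measurable weight.
-/

noncomputable section

open MeasureTheory Filter Set
open scoped ENNReal NNReal Topology BigOperators

namespace Summit.AtomisticToContinuum.BoseEinsteinCondensation.Theorems.StaticResponseToHMinusOne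

open Literature.MathematicalPhysics.QuantumManyBody.BoseGas

/-! ### The measurable envelope from below -/

section Envelope

variable {α : Type*} [MeasurableSpace α] {μ : Measure α}

/-- **Measurable envelope from below.** On a finite measure space, every function
`f : α → [0,∞]` admits a measurable `g ≤ f` such that every measurable `q ≤ f` satisfies
`q ≤ g` almost everywhere (take, for each truncation level `n`, a measurable minorant of
`min f n` with the same (finite) lower integral, and their supremum). [folklore] -/
theorem exists_measurable_envelope (μ : Measure α) [IsFiniteMeasure μ] (f : α → ℝ≥0∞) :
    ∃ g : α → ℝ≥0∞, Measurable g ∧ g ≤ f ∧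
      ∀ q : α → ℝ≥0∞, Measurable q → q ≤ f → q ≤ᵐ[μ] g := by
  -- truncations and their optimal measurable minorants
  have htr : ∀ n : ℕ, ∃ g : α → ℝ≥0∞, Measurable g ∧ (g ≤ fun x => min (f x) n) ∧
      ∫⁻ x, min (f x) n ∂μ = ∫⁻ x, g x ∂μ :=
    fun n => exists_measurable_le_lintegral_eq μ fun x => min (f x) n
  choose g hgm hgle hgeq using htr
  have hfin : ∀ n : ℕ, ∫⁻ x, g n x ∂μ ≠ ⊤ := by
    intro n
    rw [← hgeq n]
    refine ne_of_lt (lt_of_le_of_lt (lintegral_mono fun x => min_le_right _ _) ?_)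
    rw [lintegral_const]
    exact ENNReal.mul_lt_top (ENNReal.natCast_lt_top n) (measure_lt_top μ _)
  refine ⟨fun x => ⨆ n, g n x, Measurable.iSup hgm,
    fun x => iSup_le fun n => (hgle n x).trans (min_le_left _ _), fun q hq hqf => ?_⟩
  -- for each level, `min q n ≤ g n` a.e. by optimality of `g n`
  have hlev : ∀ n : ℕ, ∀ᵐ x ∂μ, min (q x) n ≤ g n x := by
    intro n
    set p : α → ℝ≥0∞ := fun x => max (min (q x) n) (g n x) with hp
    have hpm : Measurable p := (hq.min measurable_const).max (hgm n)
    have hple : p ≤ fun x => min (f x) n := fun x =>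
      max_le (min_le_min (hqf x) le_rfl) (hgle n x)
    have hgp : (fun x => g n x) ≤ᵐ[μ] p := ae_of_all _ fun x => le_max_right _ _
    have hint : ∫⁻ x, p x ∂μ ≤ ∫⁻ x, g n x ∂μ := by
      rw [← hgeq n]
      exact lintegral_mono hple
    have hae := ae_eq_of_ae_le_of_lintegral_le hgp (hfin n) hpm.aemeasurable hint
    filter_upwards [hae] with x hx
    rw [hx]
    exact le_max_left _ _
  rw [← ae_all_iff] at hlev
  filter_upwards [hlev] with x hx
  by_contra hlt
  rw [not_le] at hlt
  have htop : (⨆ n, g n x) ≠ ⊤ := ne_top_of_lt hlt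
  obtain ⟨n, hn'⟩ := ENNReal.exists_nat_gt htop
  have h1 : min (q x) n ≤ g n x := hx n
  have h2 : g n x ≤ ⨆ n, g n x := le_iSup (fun n => g n x) n
  have h3 : (⨆ n, g n x) < min (q x) n := lt_min hlt hn'
  exact absurd (h3.trans_le (h1.trans h2)) (lt_irrefl _)

/-- **Pairing identity for the envelope.** If `g ≤ f` essentially dominates every
measurable minorant of `f`, then `∫⁻ f·h = ∫⁻ g·h` for every finite-valued measurable `h ≥ 0`
(the lower integral of `f·h` is attained on a measurable minorant, which after division by `h` is
a measurable minorant of `f`). [folklore] -/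
theorem lintegral_mul_eq_of_envelope {f g : α → ℝ≥0∞} (hgf : g ≤ f)
    (henv : ∀ q : α → ℝ≥0∞, Measurable q → q ≤ f → q ≤ᵐ[μ] g) {h : α → ℝ≥0∞}
    (hh : Measurable h) (hfin : ∀ x, h x ≠ ⊤) :
    ∫⁻ x, f x * h x ∂μ = ∫⁻ x, g x * h x ∂μ := by
  refine le_antisymm ?_ (lintegral_mono fun x => mul_le_mul' (hgf x) le_rfl)
  obtain ⟨φ, hφm, hφle, hφeq⟩ := exists_measurable_le_lintegral_eq μ fun x => f x * h x
  rw [hφeq]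
  -- `φ / h` is a measurable minorant of `f`
  have hq : (fun x => φ x / h x) ≤ f := fun x => ENNReal.div_le_of_le_mul (hφle x)
  have hqm : Measurable fun x => φ x / h x := hφm.div hh
  have hφ0 : ∀ x, h x = 0 → φ x = 0 := fun x hx => by
    have := hφle x
    dsimp only at this
    rw [hx, mul_zero] at this
    exact le_antisymm this bot_le
  refine lintegral_mono_ae ?_
  filter_upwards [henv _ hqm hq] with x hx
  calc φ x = φ x / h x * h x := (ENNReal.div_mul_cancel' (hφ0 x) (fun ht => absurd ht (hfin x))).symm
    _ ≤ g x * h x := mul_le_mul' hx le_rfl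

end Envelope

/-! ### A measurable weight for the periodic energy -/

variable {N : ℕ} {L : ℝ}

/-- **A measurable weight computing the periodic energy.** For every pair profile `v` (measurable
or not) there is a measurable `W ≤ ∑_{i<j} v^per(xᵢ - xⱼ)` on `(ℝ³)^N` such that
`⟨Ψ, HΨ⟩ = ∫⁻_{cell} |∇Ψ|² + W|Ψ|²` for every periodic trial state `Ψ`, and more generally
`∫⁻_{cell} W_v · h = ∫⁻_{cell} W · h` for every finite-valued measurable `h`. [folklore] -/
theorem exists_measurable_weight (v : ℝ → ℝ≥0∞) (N : ℕ) (L : ℝ) :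
    ∃ W : Config N → ℝ≥0∞, Measurable W ∧ (W ≤ periodicInteraction v L) ∧
      (∀ h : Config N → ℝ≥0∞, Measurable h → (∀ X, h X ≠ ⊤) →
        ∫⁻ X in cellN N L, periodicInteraction v L X * h X = ∫⁻ X in cellN N L, W X * h X) ∧
      ∀ Ψ : PeriodicTrialState N L, periodicEnergy v Ψ =
        ∫⁻ X in cellN N L, kineticDensity Ψ.ψ X + W X * ((‖Ψ.ψ X‖₊ : ℝ≥0∞)) ^ 2 := by
  haveI : IsFiniteMeasure ((volume : Measure (Config N)).restrict (cellN N L)) := by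
    refine ⟨?_⟩
    rw [Measure.restrict_apply_univ, volume_cellN]
    exact ENNReal.pow_lt_top (ENNReal.pow_lt_top ENNReal.ofReal_lt_top)
  -- the kinetic density of any function is measurable (`fderiv` is measurable)
  have hkin : ∀ ψ : Config N → ℂ, Measurable (kineticDensity ψ) := fun ψ => by
    refine Finset.measurable_sum _ fun i _ => Finset.measurable_sum _ fun k _ => ?_
    exact ((measurable_fderiv_apply_const ℝ ψ _).nnnorm.coe_nnreal_ennreal).pow_const 2
  obtain ⟨W, hWm, hWle, henv⟩ :=
    exists_measurable_envelope ((volume : Measure (Config N)).restrict (cellN N L))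
      (periodicInteraction v L)
  have hpair : ∀ h : Config N → ℝ≥0∞, Measurable h → (∀ X, h X ≠ ⊤) →
      ∫⁻ X in cellN N L, periodicInteraction v L X * h X = ∫⁻ X in cellN N L, W X * h X :=
    fun h hh hfin => lintegral_mul_eq_of_envelope hWle henv hh hfin
  refine ⟨W, hWm, hWle, hpair, fun Ψ => ?_⟩
  have hh : Measurable fun X => ((‖Ψ.ψ X‖₊ : ℝ≥0∞)) ^ 2 :=
    (Ψ.contDiff.continuous.measurable.nnnorm.coe_nnreal_ennreal).pow_const _
  unfold periodicEnergy
  rw [lintegral_add_left (hkin Ψ.ψ), lintegral_add_left (hkin Ψ.ψ),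
    hpair _ hh fun X => ENNReal.pow_ne_top ENNReal.coe_ne_top]

end Summit.AtomisticToContinuum.BoseEinsteinCondensation.Theorems.StaticResponseToHMinusOne

end
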